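import Literature.AnabelianGeometry.EtaleTheta.ContH1Separated
import HarnessLib

/-!
# Continuous `H¹` with profinite coefficients: the classes of a COMPACT, pointwise-continuous family of cocycles
# form a CONGRUENCE-CLOSED set (support file for [EtTh] §1, Rmk 1.6.4 (c2) in its `a ∈ Ẑ` form)

Neukirch–Schmidt–Wingberg, *Cohomology of Number Fields*, I §2 / II §7 (continuous cochains with profinite
coefficients; `H¹` as crossed homomorphisms modulo principal ones) [cite: NeukirchSchmidtWingberg2008, I §2 and II §7];
used for Mochizuki, *The étale theta function …*, Publ. RIMS **45** (2009) [EtTh], Remark 1.6.4 p. 252 — the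
`Ẑ ∋ a` form of the action formula (c2) «`(η̈^Θ)^∧ ↦ (η̈^Θ)^∧ − 2a·log(Ü) − (a²/2)·log(q_X) + log(O^×_K̈)`»
[cite: MochizukiEtTh2009, Rmk 1.6.4 p.252]: passing from the tempered `a ∈ ℤ` to `a ∈ Ẑ` yields, for EVERY open normal
subgroup `N` of the coefficient group, SOME unit class `u_N` serving modulo `N`; ONE unit class serving for all `N`
needs the unit classes to be CONGRUENCE-CLOSED in `H¹` (abc-iut VNEXT «RMK164-(c2)-ZHAT», piece (Z5b), displayed
input of abc-iut-f-128 gen 8).  This file proves that input GENERICALLY for classes parametrised by a COMPACT space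
(pointwise-continuous representing cocycles) or by a compact GROUP (a homomorphism continuous for congruences).

PROOF-ONLY (abc-iut cell, prover abc-iut-w6-d081 gen 13; generic `ContH1` API over abc-iut-L2-t1's carrier and
abc-iut-f-128's separatedness file; no definitions, no instances, no facts).  For the tree's `ContH1 φ A H` with
PROFINITE ambient coefficient group `G′` (compact, Hausdorff, totally disconnected), `A` closed, a compact space `C`
and a family of classes `κ : C → H¹(H, A)` admitting representing cocycles `F c` (`[F c] = κ c`) such that
`c ↦ F c (h)` is continuous for each `h ∈ H` ("congruent modulo `N`" below is abc-iut-f-128's shape of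
`ContH1Separated`: SOME representatives are pointwise congruent modulo `N`):
* `ContH1.exists_eq_family_of_forall_congr` — if a class `x` is, for every open normal `N ⊴ G′`, congruent
  modulo `N` to SOME member `κ c_N` of the family, then `x = κ c` for some `c` — the sets
  `S_N = {(c, b) ∈ C × A | ∀ h, f₀(h)·(F c (h)·∂b(h))⁻¹ ∈ N}` (`f₀` a representative of `x`) are closed, non-empty
  and directed in the COMPACT `C × A` (finite-intersection property), and `⋂ N = 1`;
* `ContH1.exists_eq_mul_family_of_forall_congr` — the translate form used by (c2): if for every `N` the class
  `x` is congruent modulo `N` to `y · κ c_N` for some `c_N`, then `x = y · κ c` for some `c`;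
* `ContH1.exists_eq_mul_map_of_forall_congr` / `ContH1.mem_range_of_forall_congr` — the HOMOMORPHISM form, with no
  representatives to choose: for a compact topological group `C` and a homomorphism `κ : C →* H¹(H, A)` that is
  continuous for the congruence topology (`{c | κ c ≡ 1 mod N}` closed for every `N`), `x ≡ y·κ c_N (mod N) ∀ N`
  implies `x = y·κ c` for some `c`, and the image of `κ` is congruence-closed — at an abstract Kummer map of a compact
  unit group this reduces the displayed input to «`κ⁻¹(≡ 1 mod N)` is closed for every open normal `N`».
Mathlib + the tree's `ContH1`/`ContH1Separated` only.  Nothing here bears on [IUTchIII] Cor. 3.12; the [EtTh]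
application ((Z5b), abc-iut-f-128) is not made here; typed ≠ proved.
-/

noncomputable section

namespace Literature.AnabelianGeometry.EtaleTheta

open scoped IsMulCommutative
open Topology

namespace ContH1

variable {G G' : Type*} [Group G] [TopologicalSpace G]
  [Group G'] [TopologicalSpace G'] [IsTopologicalGroup G']
  {φ : G →* G'} {A : Subgroup G'} [A.Normal] [IsMulCommutative A] {H : Subgroup G}

/-- An element of a profinite group lying in every open normal subgroup is trivial (local copy of the folklore
step of `ContH1Separated`). [folklore] -/
private theorem eq_one_of_forall_mem_openNormal' [CompactSpace G'] [T2Space G'] [TotallyDisconnectedSpace G']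
    (g : G') (hg : ∀ N : OpenNormalSubgroup G', g ∈ N.toSubgroup) : g = 1 := by
  by_contra hne
  obtain ⟨N, hN⟩ := ProfiniteGrp.exist_openNormalSubgroup_sub_open_nhds_of_one
    (isOpen_compl_singleton (x := g)) (show (1 : G') ∈ ({g}ᶜ : Set G') from fun h1 => hne h1.symm)
  exact hN (hg N) rfl

omit [TopologicalSpace G] [IsMulCommutative A] in
/-- Continuity of the coboundary of `b` at a fixed place `h`: `b ↦ φ(h) b φ(h)⁻¹ · b⁻¹` is continuous `A → G′`
(local copy of the folklore step of `ContH1Separated`). [folklore] -/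
private theorem continuous_coboundary_apply' (h : H) :
    Continuous fun b : A => (((MulAut.conjNormal (φ (h : G)) b * b⁻¹ : A)) : G') := by
  have : (fun b : A => (((MulAut.conjNormal (φ (h : G)) b * b⁻¹ : A)) : G')) =
      fun b : A => φ (h : G) * (b : G') * (φ (h : G))⁻¹ * ((b : G'))⁻¹ := by
    funext b
    simp [MulAut.conjNormal_apply]
  rw [this]
  fun_prop

/-- Change of representative: two cocycles with the same class differ by a coboundary, pointwise (local copy of
abc-iut's `ContH1.exists_coboundary_of_mk_eq`, kept local to avoid the §2 import). [folklore] -/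
private theorem exists_coboundary_of_mk_eq'' (f f₀ : contCocycles φ A H)
    (hf : (QuotientGroup.mk f : ContH1 φ A H) = QuotientGroup.mk f₀) :
    ∃ b : A, ∀ h : H, f₀.1 h = f.1 h * (MulAut.conjNormal (φ (h : G)) b * b⁻¹) := by
  have hmem : f⁻¹ * f₀ ∈ (contCoboundaries φ A H).subgroupOf (contCocycles φ A H) :=
    (QuotientGroup.eq (s := (contCoboundaries φ A H).subgroupOf (contCocycles φ A H))).mp hf
  obtain ⟨b, hb⟩ := (mem_contCoboundaries_iff _).mp (Subgroup.mem_subgroupOf.mp hmem)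
  refine ⟨b, fun h => ?_⟩
  have hbh := congrFun hb h
  have hval : (((f⁻¹ * f₀ : contCocycles φ A H) : H → A) h) = (f.1 h)⁻¹ * f₀.1 h := by
    simp only [Subgroup.coe_mul, Subgroup.coe_inv, Pi.mul_apply, Pi.inv_apply]
  rw [hval] at hbh
  rw [← hbh, mul_inv_cancel_left]

/-- Conversely, two cocycles differing pointwise by a coboundary have the same class. [folklore] -/
private theorem mk_eq_of_forall_eq_mul_coboundary (f f₀ : contCocycles φ A H) (b : A)
    (hb : ∀ h : H, f₀.1 h = f.1 h * (MulAut.conjNormal (φ (h : G)) b * b⁻¹)) :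
    (QuotientGroup.mk f : ContH1 φ A H) = QuotientGroup.mk f₀ := by
  refine (QuotientGroup.eq (s := (contCoboundaries φ A H).subgroupOf (contCocycles φ A H))).mpr
    (Subgroup.mem_subgroupOf.mpr ((mem_contCoboundaries_iff _).mpr ⟨b, funext fun h => ?_⟩))
  have hval : (((f⁻¹ * f₀ : contCocycles φ A H) : H → A) h) = (f.1 h)⁻¹ * f₀.1 h := by
    simp only [Subgroup.coe_mul, Subgroup.coe_inv, Pi.mul_apply, Pi.inv_apply]
  rw [hval, hb h, inv_mul_cancel_left]

/-- **The classes of a compact, pointwise-continuous family of cocycles form a congruence-closed set** (profinite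
ambient coefficients, `A` closed).  Let `C` be a compact space and `F : C → contCocycles φ A H` a family of continuous
cocycles, representing the classes `κ c`, such that `c ↦ F c (h)` is continuous for every `h ∈ H`.  If a class
`x ∈ H¹(H, A)` is, for every open normal subgroup `N ⊴ G′`, congruent modulo `N` to some member of the family — i.e.
there are `c_N ∈ C` and representatives `f` of `x`, `g` of `κ c_N` with `f(h)·g(h)⁻¹ ∈ N` for all `h` — then
`x = κ c` for some `c ∈ C`.  Proof: for a fixed representative `f₀` of `x` the sets
`S_N = {(c, b) ∈ C × A | ∀ h, f₀(h)·(F c (h)·(φ(h) b φ(h)⁻¹ b⁻¹))⁻¹ ∈ N}` are closed, non-empty and directed in the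
compact `C × A`, so they have a common point `(c, b)`; then `f₀ = F c · ∂b` pointwise since `⋂ N = 1`.
[cite: NeukirchSchmidtWingberg2008, I §2 and II §7] -/
theorem exists_eq_family_of_forall_congr [CompactSpace G'] [T2Space G'] [TotallyDisconnectedSpace G']
    (hA : IsClosed (A : Set G')) {C : Type*} [TopologicalSpace C] [CompactSpace C]
    (κ : C → ContH1 φ A H) (F : C → contCocycles φ A H)
    (hFκ : ∀ c : C, (QuotientGroup.mk (F c) : ContH1 φ A H) = κ c)
    (hF : ∀ h : H, Continuous fun c : C => (F c).1 h)
    (x : ContH1 φ A H)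
    (hx : ∀ N : OpenNormalSubgroup G', ∃ c : C, ∃ f g : contCocycles φ A H,
      (QuotientGroup.mk f : ContH1 φ A H) = x ∧ (QuotientGroup.mk g : ContH1 φ A H) = κ c ∧
        ∀ h : H, ((f.1 h : A) : G') * (((g.1 h : A) : G'))⁻¹ ∈ N.toSubgroup) :
    ∃ c : C, x = κ c := by
  classical
  haveI : CompactSpace A := isCompact_iff_compactSpace.mp hA.isCompact
  haveI : Nonempty (OpenNormalSubgroup G') :=
    ⟨{ toOpenSubgroup := ⊤, isNormal' := by
        rw [OpenSubgroup.toSubgroup_top]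
        infer_instance }⟩
  induction x using QuotientGroup.induction_on with
  | H f₀ =>
    -- the closed, non-empty, directed family `S_N ⊆ C × A`
    let S : OpenNormalSubgroup G' → Set (C × A) := fun N =>
      {q : C × A | ∀ h : H,
        ((f₀.1 h : A) : G') *
            ((((F q.1).1 h * (MulAut.conjNormal (φ (h : G)) q.2 * q.2⁻¹) : A) : G'))⁻¹ ∈ N.toSubgroup}
    have hScl : ∀ N, IsClosed (S N) := by
      intro N
      have : S N = ⋂ h : H, (fun q : C × A =>
          ((f₀.1 h : A) : G') *
            ((((F q.1).1 h * (MulAut.conjNormal (φ (h : G)) q.2 * q.2⁻¹) : A) : G'))⁻¹) ⁻¹'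
            ((N.toSubgroup : Subgroup G') : Set G') := by
        ext q
        simp only [Set.mem_setOf_eq, Set.mem_iInter, Set.mem_preimage, SetLike.mem_coe, S]
      rw [this]
      refine isClosed_iInter fun h => N.toOpenSubgroup.isClosed.preimage ?_
      have h1 : Continuous fun q : C × A => (((F q.1).1 h : A) : G') :=
        continuous_subtype_val.comp ((hF h).comp continuous_fst)
      have h2 : Continuous fun q : C × A => (((MulAut.conjNormal (φ (h : G)) q.2 * q.2⁻¹ : A)) : G') :=
        (continuous_coboundary_apply' (φ := φ) h).comp continuous_snd
      have h3 : (fun q : C × A =>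
          ((f₀.1 h : A) : G') *
            ((((F q.1).1 h * (MulAut.conjNormal (φ (h : G)) q.2 * q.2⁻¹) : A) : G'))⁻¹) =
          fun q : C × A => ((f₀.1 h : A) : G') *
            ((((F q.1).1 h : A) : G') * (((MulAut.conjNormal (φ (h : G)) q.2 * q.2⁻¹ : A)) : G'))⁻¹ := by
        funext q
        simp only [Subgroup.coe_mul]
      rw [h3]
      exact continuous_const.mul (h1.mul h2).inv
    have hSne : ∀ N, (S N).Nonempty := by
      intro N
      obtain ⟨c, f, g, hf, hg, hcongr⟩ := hx N
      obtain ⟨b₁, hb₁⟩ := exists_coboundary_of_mk_eq'' f f₀ hf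
      obtain ⟨b₂, hb₂⟩ := exists_coboundary_of_mk_eq'' g (F c) (hg.trans (hFκ c).symm)
      refine ⟨(c, b₂⁻¹ * b₁), fun h => ?_⟩
      -- `f₀ · (F c · ∂(b₂⁻¹ b₁))⁻¹ = f · g⁻¹` pointwise, in the abelian group `A`
      have key : f₀.1 h * ((F c).1 h * (MulAut.conjNormal (φ (h : G)) (b₂⁻¹ * b₁) * (b₂⁻¹ * b₁)⁻¹))⁻¹ =
          f.1 h * (g.1 h)⁻¹ := by
        rw [hb₁ h, hb₂ h]
        apply Additive.ofMul.injective
        simp only [map_mul, map_inv, mul_inv_rev, inv_inv, ofMul_mul, ofMul_inv]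
        abel
      have key' := congrArg (fun a : A => (a : G')) key
      have hc := hcongr h
      simp only [Subgroup.coe_mul, Subgroup.coe_inv] at key' hc ⊢
      rw [key']
      exact hc
    have hSdir : Directed (· ⊇ ·) S := by
      intro N₁ N₂
      refine ⟨N₁ ⊓ N₂, fun q hq h => ?_, fun q hq h => ?_⟩
      · exact (show (N₁ ⊓ N₂).toSubgroup ≤ N₁.toSubgroup from inf_le_left) (hq h)
      · exact (show (N₁ ⊓ N₂).toSubgroup ≤ N₂.toSubgroup from inf_le_right) (hq h)
    obtain ⟨q, hq⟩ := IsCompact.nonempty_iInter_of_directed_nonempty_isCompact_isClosed S hSdir hSne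
      (fun N => (hScl N).isCompact) hScl
    -- the common point `q = (c, b)` works everywhere: `f₀ = F c · ∂b` pointwise
    refine ⟨q.1, ((mk_eq_of_forall_eq_mul_coboundary (F q.1) f₀ q.2 fun h => ?_).symm).trans (hFκ q.1)⟩
    have hall : ∀ N : OpenNormalSubgroup G',
        ((f₀.1 h : A) : G') *
            ((((F q.1).1 h * (MulAut.conjNormal (φ (h : G)) q.2 * q.2⁻¹) : A) : G'))⁻¹ ∈ N.toSubgroup :=
      fun N => (Set.mem_iInter.mp hq N) h
    have h1 := eq_one_of_forall_mem_openNormal' _ hall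
    exact Subtype.ext (mul_inv_eq_one.mp h1)

/-- **Translate form** (the shape of [EtTh] Rmk 1.6.4 (c2): `σ̂·x̂ = x̂ · L̂^(−2a) · Q̂^(−a²) · u`, `u` a unit class):
with `C`, `κ`, `F` as above, if for every open normal `N ⊴ G′` the class `x` is congruent modulo `N` to `y · κ c_N` for
some `c_N ∈ C`, then `x = y · κ c` for some `c ∈ C` (apply the previous theorem to `y⁻¹·x`, congruence being
multiplicative — abc-iut-f-128's `ContH1.exists_rep_congr_mul`). [cite: NeukirchSchmidtWingberg2008, I §2 and II §7] -/
theorem exists_eq_mul_family_of_forall_congr [CompactSpace G'] [T2Space G'] [TotallyDisconnectedSpace G']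
    (hA : IsClosed (A : Set G')) {C : Type*} [TopologicalSpace C] [CompactSpace C]
    (κ : C → ContH1 φ A H) (F : C → contCocycles φ A H)
    (hFκ : ∀ c : C, (QuotientGroup.mk (F c) : ContH1 φ A H) = κ c)
    (hF : ∀ h : H, Continuous fun c : C => (F c).1 h)
    (x y : ContH1 φ A H)
    (hx : ∀ N : OpenNormalSubgroup G', ∃ c : C, ∃ f g : contCocycles φ A H,
      (QuotientGroup.mk f : ContH1 φ A H) = x ∧ (QuotientGroup.mk g : ContH1 φ A H) = y * κ c ∧
        ∀ h : H, ((f.1 h : A) : G') * (((g.1 h : A) : G'))⁻¹ ∈ N.toSubgroup) :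
    ∃ c : C, x = y * κ c := by
  -- `y⁻¹ · x ≡ [F c_N] (mod N)` for every `N`
  have hx' : ∀ N : OpenNormalSubgroup G', ∃ c : C, ∃ f g : contCocycles φ A H,
      (QuotientGroup.mk f : ContH1 φ A H) = y⁻¹ * x ∧
        (QuotientGroup.mk g : ContH1 φ A H) = κ c ∧
        ∀ h : H, ((f.1 h : A) : G') * (((g.1 h : A) : G'))⁻¹ ∈ N.toSubgroup := by
    intro N
    obtain ⟨c, f, g, hf, hg, hcongr⟩ := hx N
    obtain ⟨g₀, hg₀⟩ := QuotientGroup.mk_surjective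
      (s := (contCoboundaries φ A H).subgroupOf (contCocycles φ A H)) y
    -- `y⁻¹ ≡ y⁻¹ (mod N)` with the representative `g₀⁻¹` on both sides
    have hinv : (QuotientGroup.mk (g₀⁻¹) : ContH1 φ A H) = y⁻¹ := by
      rw [← hg₀]
      rfl
    have hyy : ∃ f' g' : contCocycles φ A H, (QuotientGroup.mk f' : ContH1 φ A H) = y⁻¹ ∧
        (QuotientGroup.mk g' : ContH1 φ A H) = y⁻¹ ∧
        ∀ h : H, ((f'.1 h : A) : G') * (((g'.1 h : A) : G'))⁻¹ ∈ N.toSubgroup :=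
      ⟨g₀⁻¹, g₀⁻¹, hinv, hinv, fun h => by
        rw [mul_inv_cancel]
        exact N.toSubgroup.one_mem⟩
    obtain ⟨f', g', hf', hg', hc'⟩ := exists_rep_congr_mul N.toSubgroup hyy ⟨f, g, hf, hg, hcongr⟩
    refine ⟨c, f', g', hf', ?_, hc'⟩
    rw [hg']
    exact inv_mul_cancel_left y _
  obtain ⟨c, hc⟩ := exists_eq_family_of_forall_congr hA κ F hFκ hF (y⁻¹ * x) hx'
  refine ⟨c, ?_⟩
  rw [← hc]
  exact (mul_inv_cancel_left y x).symm

/-! ### The homomorphism form: a compact group mapped to `H¹` continuously for the congruence topology -/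

/-- Reflexivity of congruence modulo `N`: every class has a representative, congruent to itself. [folklore] -/
private theorem congr_refl (N : Subgroup G') (z : ContH1 φ A H) :
    ∃ f g : contCocycles φ A H, (QuotientGroup.mk f : ContH1 φ A H) = z ∧
      (QuotientGroup.mk g : ContH1 φ A H) = z ∧ ∀ h : H, ((f.1 h : A) : G') * (((g.1 h : A) : G'))⁻¹ ∈ N := by
  obtain ⟨f₀, hf₀⟩ := QuotientGroup.mk_surjective
    (s := (contCoboundaries φ A H).subgroupOf (contCocycles φ A H)) z
  exact ⟨f₀, f₀, hf₀, hf₀, fun h => by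
    rw [mul_inv_cancel]
    exact N.one_mem⟩

/-- Congruence modulo `N` passes to inverses (`A` abelian). [folklore] -/
private theorem congr_inv (N : Subgroup G') {z w : ContH1 φ A H}
    (hzw : ∃ f g : contCocycles φ A H, (QuotientGroup.mk f : ContH1 φ A H) = z ∧
      (QuotientGroup.mk g : ContH1 φ A H) = w ∧ ∀ h : H, ((f.1 h : A) : G') * (((g.1 h : A) : G'))⁻¹ ∈ N) :
    ∃ f g : contCocycles φ A H, (QuotientGroup.mk f : ContH1 φ A H) = z⁻¹ ∧
      (QuotientGroup.mk g : ContH1 φ A H) = w⁻¹ ∧ ∀ h : H, ((f.1 h : A) : G') * (((g.1 h : A) : G'))⁻¹ ∈ N := by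
  obtain ⟨f, g, hf, hg, hc⟩ := hzw
  refine ⟨f⁻¹, g⁻¹, by rw [← hf]; rfl, by rw [← hg]; rfl, fun h => ?_⟩
  have key : ((f⁻¹ : contCocycles φ A H).1 h) * ((g⁻¹ : contCocycles φ A H).1 h)⁻¹ = (f.1 h * (g.1 h)⁻¹)⁻¹ := by
    have hv1 : (f⁻¹ : contCocycles φ A H).1 h = (f.1 h)⁻¹ := rfl
    have hv2 : (g⁻¹ : contCocycles φ A H).1 h = (g.1 h)⁻¹ := rfl
    rw [hv1, hv2]
    apply Additive.ofMul.injective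
    simp only [mul_inv_rev, inv_inv, ofMul_mul, ofMul_inv]
    abel
  have key' := congrArg (fun a : A => (a : G')) key
  have hc' := N.inv_mem (hc h)
  simp only [Subgroup.coe_mul, Subgroup.coe_inv] at key' hc' ⊢
  rw [key']
  exact hc'

/-- Classes congruent to `1` modulo `N` are closed under products. [folklore] -/
private theorem congr_one_mul (N : Subgroup G') {a b : ContH1 φ A H}
    (ha : ∃ f g : contCocycles φ A H, (QuotientGroup.mk f : ContH1 φ A H) = a ∧
      (QuotientGroup.mk g : ContH1 φ A H) = (1 : ContH1 φ A H) ∧ ∀ h : H, ((f.1 h : A) : G') * (((g.1 h : A) : G'))⁻¹ ∈ N)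
    (hb : ∃ f g : contCocycles φ A H, (QuotientGroup.mk f : ContH1 φ A H) = b ∧
      (QuotientGroup.mk g : ContH1 φ A H) = (1 : ContH1 φ A H) ∧ ∀ h : H, ((f.1 h : A) : G') * (((g.1 h : A) : G'))⁻¹ ∈ N) :
    ∃ f g : contCocycles φ A H, (QuotientGroup.mk f : ContH1 φ A H) = a * b ∧
      (QuotientGroup.mk g : ContH1 φ A H) = (1 : ContH1 φ A H) ∧ ∀ h : H, ((f.1 h : A) : G') * (((g.1 h : A) : G'))⁻¹ ∈ N := by
  obtain ⟨f, g, hf, hg, hc⟩ := exists_rep_congr_mul N ha hb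
  exact ⟨f, g, hf, by rw [hg, mul_one], hc⟩

/-- Classes congruent to `1` modulo `N` are closed under inverses. [folklore] -/
private theorem congr_one_inv (N : Subgroup G') {a : ContH1 φ A H}
    (ha : ∃ f g : contCocycles φ A H, (QuotientGroup.mk f : ContH1 φ A H) = a ∧
      (QuotientGroup.mk g : ContH1 φ A H) = (1 : ContH1 φ A H) ∧ ∀ h : H, ((f.1 h : A) : G') * (((g.1 h : A) : G'))⁻¹ ∈ N) :
    ∃ f g : contCocycles φ A H, (QuotientGroup.mk f : ContH1 φ A H) = a⁻¹ ∧
      (QuotientGroup.mk g : ContH1 φ A H) = (1 : ContH1 φ A H) ∧ ∀ h : H, ((f.1 h : A) : G') * (((g.1 h : A) : G'))⁻¹ ∈ N := by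
  obtain ⟨f, g, hf, hg, hc⟩ := congr_inv N ha
  exact ⟨f, g, hf, by rw [hg, inv_one], hc⟩

/-- **Homomorphism form** (the shape of the unit term of [EtTh] Rmk 1.6.4 (c2) at an abstract Kummer map): let `C` be a
COMPACT topological group and `κ : C →* H¹(H, A)` a homomorphism which is CONTINUOUS FOR THE CONGRUENCE TOPOLOGY — for
every open normal `N ⊴ G′` the set `{c | κ c ≡ 1 (mod N)}` is closed in `C`.  If for every `N` the class `x` is congruent
modulo `N` to `y · κ c_N` for some `c_N ∈ C`, then `x = y · κ c` for some `c ∈ C`.  Proof: with `z := y⁻¹x`, the sets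
`S_N = {c | z·(κ c)⁻¹ ≡ 1 (mod N)} = (c ↦ c_N·c⁻¹)⁻¹ {d | κ d ≡ 1 (mod N)}` are closed, non-empty and directed in the compact
`C`; a common point `c` gives `z·(κ c)⁻¹ ≡ 1` modulo every `N`, hence `z = κ c` by separatedness
(abc-iut-f-128's `ContH1.eq_of_forall_exists_rep_congr`). [cite: NeukirchSchmidtWingberg2008, I §2 and II §7] -/
theorem exists_eq_mul_map_of_forall_congr [CompactSpace G'] [T2Space G'] [TotallyDisconnectedSpace G']
    (hA : IsClosed (A : Set G')) {C : Type*} [Group C] [TopologicalSpace C] [IsTopologicalGroup C] [CompactSpace C]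
    (κ : C →* ContH1 φ A H)
    (hκ : ∀ N : OpenNormalSubgroup G', IsClosed {c : C | ∃ f g : contCocycles φ A H,
      (QuotientGroup.mk f : ContH1 φ A H) = κ c ∧ (QuotientGroup.mk g : ContH1 φ A H) = (1 : ContH1 φ A H) ∧
        ∀ h : H, ((f.1 h : A) : G') * (((g.1 h : A) : G'))⁻¹ ∈ N.toSubgroup})
    (x y : ContH1 φ A H)
    (hx : ∀ N : OpenNormalSubgroup G', ∃ c : C, ∃ f g : contCocycles φ A H,
      (QuotientGroup.mk f : ContH1 φ A H) = x ∧ (QuotientGroup.mk g : ContH1 φ A H) = y * κ c ∧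
        ∀ h : H, ((f.1 h : A) : G') * (((g.1 h : A) : G'))⁻¹ ∈ N.toSubgroup) :
    ∃ c : C, x = y * κ c := by
  classical
  haveI : Nonempty (OpenNormalSubgroup G') :=
    ⟨{ toOpenSubgroup := ⊤, isNormal' := by
        rw [OpenSubgroup.toSubgroup_top]
        infer_instance }⟩
  obtain ⟨z, hz⟩ : ∃ z : ContH1 φ A H, z = y⁻¹ * x := ⟨_, rfl⟩
  -- for every `N`: some `c_N` with `z · (κ c_N)⁻¹ ≡ 1 (mod N)`
  have hzN : ∀ N : OpenNormalSubgroup G', ∃ cN : C, ∃ f g : contCocycles φ A H,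
      (QuotientGroup.mk f : ContH1 φ A H) = z * (κ cN)⁻¹ ∧ (QuotientGroup.mk g : ContH1 φ A H) = (1 : ContH1 φ A H) ∧
        ∀ h : H, ((f.1 h : A) : G') * (((g.1 h : A) : G'))⁻¹ ∈ N.toSubgroup := by
    intro N
    obtain ⟨cN, hcN⟩ := hx N
    have h1 := exists_rep_congr_mul N.toSubgroup (congr_refl N.toSubgroup y⁻¹) hcN
    have h2 := exists_rep_congr_mul N.toSubgroup h1 (congr_refl N.toSubgroup (κ cN)⁻¹)
    obtain ⟨f', g', hf', hg', hc'⟩ := h2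
    refine ⟨cN, f', g', by rw [hf', hz], ?_, hc'⟩
    rw [hg', inv_mul_cancel_left, mul_inv_cancel]
  -- the closed, non-empty, directed family `S_N ⊆ C`
  let S : OpenNormalSubgroup G' → Set C := fun N =>
    {c : C | ∃ f g : contCocycles φ A H,
      (QuotientGroup.mk f : ContH1 φ A H) = z * (κ c)⁻¹ ∧ (QuotientGroup.mk g : ContH1 φ A H) = (1 : ContH1 φ A H) ∧
        ∀ h : H, ((f.1 h : A) : G') * (((g.1 h : A) : G'))⁻¹ ∈ N.toSubgroup}
  have hScl : ∀ N, IsClosed (S N) := by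
    intro N
    obtain ⟨cN, hcN⟩ := hzN N
    have hS : S N = (fun c : C => cN * c⁻¹) ⁻¹' {d : C | ∃ f g : contCocycles φ A H,
        (QuotientGroup.mk f : ContH1 φ A H) = κ d ∧ (QuotientGroup.mk g : ContH1 φ A H) = (1 : ContH1 φ A H) ∧
          ∀ h : H, ((f.1 h : A) : G') * (((g.1 h : A) : G'))⁻¹ ∈ N.toSubgroup} := by
      ext c
      simp only [Set.mem_setOf_eq, Set.mem_preimage, S]
      have hid₁ : κ (cN * c⁻¹) = (z * (κ cN)⁻¹)⁻¹ * (z * (κ c)⁻¹) := by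
        rw [map_mul, map_inv, mul_inv_rev, inv_inv, mul_assoc, inv_mul_cancel_left]
      have hid₂ : z * (κ c)⁻¹ = (z * (κ cN)⁻¹) * κ (cN * c⁻¹) := by
        rw [map_mul, map_inv, mul_assoc, inv_mul_cancel_left]
      constructor
      · intro hcS
        rw [hid₁]
        exact congr_one_mul N.toSubgroup (congr_one_inv N.toSubgroup hcN) hcS
      · intro hd
        rw [hid₂]
        exact congr_one_mul N.toSubgroup hcN hd
    rw [hS]
    exact (hκ N).preimage (continuous_const.mul continuous_inv)
  have hSne : ∀ N, (S N).Nonempty := fun N => by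
    obtain ⟨cN, hcN⟩ := hzN N
    exact ⟨cN, hcN⟩
  have hSdir : Directed (· ⊇ ·) S := by
    intro N₁ N₂
    refine ⟨N₁ ⊓ N₂, fun c hc => ?_, fun c hc => ?_⟩
    · obtain ⟨f, g, hf, hg, hcg⟩ := hc
      exact ⟨f, g, hf, hg, fun h =>
        (show (N₁ ⊓ N₂).toSubgroup ≤ N₁.toSubgroup from inf_le_left) (hcg h)⟩
    · obtain ⟨f, g, hf, hg, hcg⟩ := hc
      exact ⟨f, g, hf, hg, fun h =>
        (show (N₁ ⊓ N₂).toSubgroup ≤ N₂.toSubgroup from inf_le_right) (hcg h)⟩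
  obtain ⟨c, hc⟩ := IsCompact.nonempty_iInter_of_directed_nonempty_isCompact_isClosed S hSdir hSne
    (fun N => (hScl N).isCompact) hScl
  -- the common point: `z · (κ c)⁻¹ ≡ 1` modulo every `N`, hence `= 1`
  have hall : ∀ N : OpenNormalSubgroup G', ∃ f g : contCocycles φ A H,
      (QuotientGroup.mk f : ContH1 φ A H) = z * (κ c)⁻¹ ∧ (QuotientGroup.mk g : ContH1 φ A H) = (1 : ContH1 φ A H) ∧
        ∀ h : H, ((f.1 h : A) : G') * (((g.1 h : A) : G'))⁻¹ ∈ N.toSubgroup :=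
    fun N => Set.mem_iInter.mp hc N
  have hz1 : z * (κ c)⁻¹ = 1 := eq_of_forall_exists_rep_congr hA _ _ hall
  refine ⟨c, ?_⟩
  rw [mul_inv_eq_one] at hz1
  rw [← hz1, hz, mul_inv_cancel_left]

/-- **Set form of the homomorphism version**: the image of a compact topological group under a homomorphism to
`H¹(H, A)` that is continuous for the congruence topology is CONGRUENCE-CLOSED.  (At an abstract Kummer map
`κ : O^× → H¹` of a compact unit group this is the displayed input «`log(O^×)` is congruence-closed» of the `a ∈ Ẑ`
form of [EtTh] Rmk 1.6.4 (c2), reduced to «`κ⁻¹(≡ 1 mod N)` is closed for every `N`».)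
[cite: NeukirchSchmidtWingberg2008, I §2 and II §7] [cite: MochizukiEtTh2009, Rmk 1.6.4 p.252] -/
theorem mem_range_of_forall_congr [CompactSpace G'] [T2Space G'] [TotallyDisconnectedSpace G']
    (hA : IsClosed (A : Set G')) {C : Type*} [Group C] [TopologicalSpace C] [IsTopologicalGroup C] [CompactSpace C]
    (κ : C →* ContH1 φ A H)
    (hκ : ∀ N : OpenNormalSubgroup G', IsClosed {c : C | ∃ f g : contCocycles φ A H,
      (QuotientGroup.mk f : ContH1 φ A H) = κ c ∧ (QuotientGroup.mk g : ContH1 φ A H) = (1 : ContH1 φ A H) ∧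
        ∀ h : H, ((f.1 h : A) : G') * (((g.1 h : A) : G'))⁻¹ ∈ N.toSubgroup})
    (x : ContH1 φ A H)
    (hx : ∀ N : OpenNormalSubgroup G', ∃ u ∈ Set.range κ, ∃ f g : contCocycles φ A H,
      (QuotientGroup.mk f : ContH1 φ A H) = x ∧ (QuotientGroup.mk g : ContH1 φ A H) = u ∧
        ∀ h : H, ((f.1 h : A) : G') * (((g.1 h : A) : G'))⁻¹ ∈ N.toSubgroup) :
    x ∈ Set.range κ := by
  have hx' : ∀ N : OpenNormalSubgroup G', ∃ c : C, ∃ f g : contCocycles φ A H,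
      (QuotientGroup.mk f : ContH1 φ A H) = x ∧ (QuotientGroup.mk g : ContH1 φ A H) = (1 : ContH1 φ A H) * κ c ∧
        ∀ h : H, ((f.1 h : A) : G') * (((g.1 h : A) : G'))⁻¹ ∈ N.toSubgroup := by
    intro N
    obtain ⟨u, ⟨c, rfl⟩, f, g, hf, hg, hcongr⟩ := hx N
    exact ⟨c, f, g, hf, by rw [one_mul]; exact hg, hcongr⟩
  obtain ⟨c, hc⟩ := exists_eq_mul_map_of_forall_congr hA κ hκ x 1 hx'
  exact ⟨c, by rw [hc, one_mul]⟩

end ContH1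

end Literature.AnabelianGeometry.EtaleTheta

end
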